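/-
Copyright (c) 2026 the pub-hodgecm-mathlib formalisation cell (harness21).  Prover seat hodgecm-mathlib-K2E3-p17 (g6), Track B «K2-LIT» ∕ h413
(`stmt-HodgeConjecture-24833`), line `K2_E3_EllipticInputs`, unit U12 §L, roads (F-E)∕(LBGL-3E) (owner K2E3-p11) and «GL-[M6]-sc» (owner K2E3-p23),
brick H″4 = B4-1m (disc-null half) «THE SINGULAR SET `{disc χ = 0}` OF `𝔤𝔩₃(F)` AND OF THE PARABOLIC SLICE `𝔭_{(2,1)}` IS HAAR-NULL».  2026-09-04.
-/
import Summits.HodgeConjecture.HodgeConjecture.Theorems.K2E3GL3SplitTorusWeylKit   -- ★ p857820 (this seat, H1a): `discr_charpoly_diagonal`, `delta_ne_zero`; brings the local-field kit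
import Literature.MeasureTheory.Constructions.MvPolynomialZeroSetNull                -- ★ `pi_zeroLocus_mvPolynomial_eq_zero`
import Literature.NumberTheory.Automorphic.LocalFieldHaarBalls                       -- ★ `LocalFieldHaar.measure_singleton_zero`, `exists_normAbs_eq_inv`
import Summits.HodgeConjecture.HodgeConjecture.Theorems.F0P3cStCharTSHCDGroupToLie          -- ★ `continuous_discr_charpoly` (3 × 3)
import Mathlib.RingTheory.Polynomial.Resultant.Basic
import HarnessLib

/-!
# K2_E3 road (h413), §L — brick H″4 ∕ B4-1m: `μ𝔤 {X ∈ 𝔤𝔩₃(F) | disc χ_X = 0} = 0` and `dx^{⊗7} {r | disc χ_{P(r)} = 0} = 0`, `P(r) = [[r₀,r₁,r₂],[r₃,r₄,r₅],[0,0,r₆]]`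

Cell `pub/hodgecm-mathlib` (D-0151), Track B, seat K2E3-p17 (g6); dealt BY NAME by the (F-E) road owner K2E3-p11 (g5) 06:38:24Z (heads verbatim), also the
disc-null half of K2E3-p23's B4-1m (one brick serves both roads).  `--supports stmt-HodgeConjecture-24833 --as helper`; THEOREMS ONLY (no definition ∕ instance ∕
notation ∕ named fact ∕ `sorry`); never imports `Cruxes/…/Lines`.  COUNT-NEUTRAL.

ROAD (the `𝔤𝔩₂` twin is ★ `K2E3GL2RegularSetLimitDensity.measure_setOf_discr_charpoly_eq_zero`; NO explicit nine-variable discriminant is written).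
§1 Over any commutative ring: for a `3 × 3` matrix `U` with entries in `MvPolynomial (Fin n) R`, `disc χ_{U(y)} = eval_y (disc χ_U)` (Mathlib `Matrix.charpoly_map`
and the degree-`3` discriminant formula `discr_of_degree_eq_three` on both sides); the UNIVERSAL matrices `U₉ = (X_{3i+j})`, `U₇ = [[X₀,X₁,X₂],[X₃,X₄,X₅],[0,0,X₆]]`;
`disc χ_{U} ≠ 0` because it evaluates to `Δ(0,1,a)² ≠ 0` at the coordinates of `diag(0,1,a)`, `a ∉ {0,1}` (★ H1a).  §2 Over a non-archimedean local field: an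
additive Haar measure on `F` is atomless, so the zero locus of a non-zero polynomial is `dx^{⊗n}`-null (★ `pi_zeroLocus_mvPolynomial_eq_zero`); head (2) is this
verbatim for `U₇`; head (1) follows for `U₉` through the entry chart `F⁹ ≃ M₃(F)` and uniqueness of Haar measure (`μ𝔤 = a · chart_* dx^{⊗9}`).
[HarishChandra1999AdmissibleDistributions, §7 (the regular set has null complement)] [HarishChandra1970, Part I §5] [WeilBNT1967, Ch. I §2]
HONEST LABEL: HC_CM is proved only modulo the 7 printed citations (2 remaining named inputs: hLiu418 = stmt-HodgeConjecture-24832, h413 = stmt-HodgeConjecture-24833)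
until rung 0 closes; count-neutral helper.

## References
* [HarishChandra1999AdmissibleDistributions] Harish-Chandra (DeBacker–Sally), *Admissible Invariant Distributions on Reductive p-adic Groups* (1999), §7.
* [HarishChandra1970] Harish-Chandra (van Dijk), *Harmonic Analysis on Reductive p-adic Groups*, LNM 162 (1970), Part I §5.
* [WeilBNT1967] A. Weil, *Basic Number Theory* (1967), Ch. I §2.
-/

set_option autoImplicit false
set_option linter.dupNamespace false

noncomputable section

open MeasureTheory Measure Filter Topology Set Matrix ValuativeRel Polynomial
open scoped MatrixGroups NNReal ENNReal Valued
open Literature.NumberTheory.Automorphic Literature.NumberTheory.Automorphic.LocalFieldHaar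
open Literature.NumberTheory.GaloisRepresentations Literature.NumberTheory.GaloisRepresentations.IsNonarchimedeanLocalField
open Summit.HodgeConjecture.HodgeConjecture.Cruxes.H413.K2E3GL3SplitTorusWeylKit

namespace Summit.HodgeConjecture.HodgeConjecture.Cruxes.H413.K2E3GL3CharpolyDiscNull

/-! ## §1  `disc χ` of a polynomial matrix family is a polynomial; the universal matrices -/

section Algebra

variable {R : Type*} [CommRing R] [Nontrivial R]

/-- **`disc χ_{U(y)} = eval_y (disc χ_U)`** for a `3 × 3` matrix `U` of polynomials (`χ_{U(y)} = χ_U(y)` by `Matrix.charpoly_map`; the discriminant of a cubic is a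
fixed polynomial in its coefficients). [folklore] -/
theorem discr_charpoly_map_eval {n : ℕ} (U : Matrix (Fin 3) (Fin 3) (MvPolynomial (Fin n) R)) (y : Fin n → R) :
    (U.map (MvPolynomial.eval y)).charpoly.discr = MvPolynomial.eval y U.charpoly.discr := by
  have h3 : (U.map (MvPolynomial.eval y)).charpoly.degree = 3 := by rw [Matrix.charpoly_degree_eq_dim]; rfl
  have h3' : U.charpoly.degree = 3 := by rw [Matrix.charpoly_degree_eq_dim]; rfl
  rw [discr_of_degree_eq_three h3, discr_of_degree_eq_three h3', Matrix.charpoly_map]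
  simp only [Polynomial.coeff_map, map_add, map_sub, map_mul, map_pow, map_ofNat]

omit [Nontrivial R] in
/-- The universal full matrix `U₉(y) = [[y₀,y₁,y₂],[y₃,y₄,y₅],[y₆,y₇,y₈]]`. [folklore] -/
theorem map_eval_universal_nine (y : Fin 9 → R) :
    ((!![MvPolynomial.X 0, MvPolynomial.X 1, MvPolynomial.X 2; MvPolynomial.X 3, MvPolynomial.X 4, MvPolynomial.X 5;
        MvPolynomial.X 6, MvPolynomial.X 7, MvPolynomial.X 8] : Matrix (Fin 3) (Fin 3) (MvPolynomial (Fin 9) R)).map (MvPolynomial.eval y)) =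
      !![y 0, y 1, y 2; y 3, y 4, y 5; y 6, y 7, y 8] := by
  ext i j; fin_cases i <;> fin_cases j <;> simp

omit [Nontrivial R] in
/-- The universal parabolic matrix `U₇(r) = [[r₀,r₁,r₂],[r₃,r₄,r₅],[0,0,r₆]]`. [folklore] -/
theorem map_eval_universal_seven (r : Fin 7 → R) :
    ((!![MvPolynomial.X 0, MvPolynomial.X 1, MvPolynomial.X 2; MvPolynomial.X 3, MvPolynomial.X 4, MvPolynomial.X 5;
        0, 0, MvPolynomial.X 6] : Matrix (Fin 3) (Fin 3) (MvPolynomial (Fin 7) R)).map (MvPolynomial.eval r)) =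
      !![r 0, r 1, r 2; r 3, r 4, r 5; 0, 0, r 6] := by
  ext i j; fin_cases i <;> fin_cases j <;> simp

end Algebra

section Field

variable {K : Type*} [Field K]

/-- **`disc χ_{U₉} ≠ 0`**: at the coordinates of `diag(0, 1, a)` (`a ∉ {0,1}`) it is `Δ(0,1,a)² ≠ 0`. [cite: HarishChandra1970, Part I §5] -/
theorem discr_charpoly_universal_nine_ne_zero {a : K} (ha0 : a ≠ 0) (ha1 : a ≠ 1) :
    ((!![MvPolynomial.X 0, MvPolynomial.X 1, MvPolynomial.X 2; MvPolynomial.X 3, MvPolynomial.X 4, MvPolynomial.X 5;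
        MvPolynomial.X 6, MvPolynomial.X 7, MvPolynomial.X 8] : Matrix (Fin 3) (Fin 3) (MvPolynomial (Fin 9) K))).charpoly.discr ≠ 0 := by
  intro h
  have h1 := discr_charpoly_map_eval (!![MvPolynomial.X 0, MvPolynomial.X 1, MvPolynomial.X 2; MvPolynomial.X 3, MvPolynomial.X 4, MvPolynomial.X 5;
        MvPolynomial.X 6, MvPolynomial.X 7, MvPolynomial.X 8] : Matrix (Fin 3) (Fin 3) (MvPolynomial (Fin 9) K)) (![0, 0, 0, 0, 1, 0, 0, 0, a] : Fin 9 → K)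
  have hdiag : ((!![MvPolynomial.X 0, MvPolynomial.X 1, MvPolynomial.X 2; MvPolynomial.X 3, MvPolynomial.X 4, MvPolynomial.X 5;
        MvPolynomial.X 6, MvPolynomial.X 7, MvPolynomial.X 8] : Matrix (Fin 3) (Fin 3) (MvPolynomial (Fin 9) K)).map
        (MvPolynomial.eval (![0, 0, 0, 0, 1, 0, 0, 0, a] : Fin 9 → K))) = Matrix.diagonal ![0, 1, a] := by
    ext i j; fin_cases i <;> fin_cases j <;> simp
  rw [h, map_zero, hdiag, discr_charpoly_diagonal] at h1
  have hinj : Function.Injective (![(0 : K), 1, a]) := by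
    intro i j hij
    fin_cases i <;> fin_cases j <;>
      first | rfl | (exfalso; simp [ha0, ha1, ha0.symm, ha1.symm] at hij)
  exact pow_ne_zero 2 (delta_ne_zero hinj) h1

/-- **`disc χ_{U₇} ≠ 0`** (same witness, now `P(0,0,0,0,1,0,a) = diag(0,1,a)`). [cite: HarishChandra1970, Part I §5] -/
theorem discr_charpoly_universal_seven_ne_zero {a : K} (ha0 : a ≠ 0) (ha1 : a ≠ 1) :
    ((!![MvPolynomial.X 0, MvPolynomial.X 1, MvPolynomial.X 2; MvPolynomial.X 3, MvPolynomial.X 4, MvPolynomial.X 5;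
        0, 0, MvPolynomial.X 6] : Matrix (Fin 3) (Fin 3) (MvPolynomial (Fin 7) K))).charpoly.discr ≠ 0 := by
  intro h
  have h1 := discr_charpoly_map_eval (!![MvPolynomial.X 0, MvPolynomial.X 1, MvPolynomial.X 2; MvPolynomial.X 3, MvPolynomial.X 4, MvPolynomial.X 5;
        0, 0, MvPolynomial.X 6] : Matrix (Fin 3) (Fin 3) (MvPolynomial (Fin 7) K)) (![0, 0, 0, 0, 1, 0, a] : Fin 7 → K)
  have hdiag : ((!![MvPolynomial.X 0, MvPolynomial.X 1, MvPolynomial.X 2; MvPolynomial.X 3, MvPolynomial.X 4, MvPolynomial.X 5;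
        0, 0, MvPolynomial.X 6] : Matrix (Fin 3) (Fin 3) (MvPolynomial (Fin 7) K)).map
        (MvPolynomial.eval (![0, 0, 0, 0, 1, 0, a] : Fin 7 → K))) = Matrix.diagonal ![0, 1, a] := by
    ext i j; fin_cases i <;> fin_cases j <;> simp
  rw [h, map_zero, hdiag, discr_charpoly_diagonal] at h1
  have hinj : Function.Injective (![(0 : K), 1, a]) := by
    intro i j hij
    fin_cases i <;> fin_cases j <;>
      first | rfl | (exfalso; simp [ha0, ha1, ha0.symm, ha1.symm] at hij)
  exact pow_ne_zero 2 (delta_ne_zero hinj) h1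

end Field

/-! ## §2  Over a non-archimedean local field: the two null-set statements -/

section LocalField

variable {F : Type*} [Field F] [ValuativeRel F] [TopologicalSpace F] [IsNonarchimedeanLocalField F] [MeasurableSpace F] [BorelSpace F]

/-- **An additive Haar measure on `F` is atomless** (translate `{x}` to `{0}`, ★ `measure_singleton_zero`). [cite: WeilBNT1967, Ch. I §2] -/
theorem nullSingletonClass_of_isAddHaarMeasure (dx : Measure F) [dx.IsAddHaarMeasure] : NullSingletonClass dx := by
  haveI : T2Space F := (isLocalField F).toT2Space
  haveI : LocallyCompactSpace F := (isLocalField F).toLocallyCompactSpace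
  haveI : IsTopologicalRing F := inferInstance
  refine ⟨fun x => ?_⟩
  have h := measure_preimage_add dx (-x) ({0} : Set F)
  have hset : (fun y : F => -x + y) ⁻¹' ({0} : Set F) = {x} := by
    ext y
    simp only [Set.mem_preimage, Set.mem_singleton_iff, neg_add_eq_zero]
    exact eq_comm
  rw [hset] at h
  rw [h, measure_singleton_zero dx]

omit [MeasurableSpace F] [BorelSpace F] in
/-- A local field has an element outside `{0, 1}` (a uniformizer). [folklore] -/
theorem exists_ne_zero_ne_one : ∃ a : F, a ≠ 0 ∧ a ≠ 1 := by
  obtain ⟨ϖ, hϖ0, hϖ⟩ := exists_normAbs_eq_inv (F := F)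
  refine ⟨ϖ, hϖ0, fun h => ?_⟩
  rw [h, map_one] at hϖ
  exact (inv_residueFieldCard_lt_one (F := F)).ne' hϖ

/-- **(2) THE SINGULAR SET OF THE PARABOLIC SLICE IS NULL**: `dx^{⊗7} {r | disc χ_{P(r)} = 0} = 0`, `P(r) = [[r₀,r₁,r₂],[r₃,r₄,r₅],[0,0,r₆]]`.
[cite: HarishChandra1999AdmissibleDistributions, §7] [cite: WeilBNT1967, Ch. I §2] -/
theorem pi_setOf_discr_charpoly_parabolic_eq_zero (dx : Measure F) [dx.IsAddHaarMeasure] :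
    (Measure.pi fun _ : Fin 7 => dx) {r : Fin 7 → F | (!![r 0, r 1, r 2; r 3, r 4, r 5; 0, 0, r 6] : Matrix (Fin 3) (Fin 3) F).charpoly.discr = 0} = 0 := by
  classical
  haveI : T2Space F := (isLocalField F).toT2Space
  haveI : LocallyCompactSpace F := (isLocalField F).toLocallyCompactSpace
  haveI : SecondCountableTopology F := secondCountableTopology_localField F
  haveI : IsTopologicalRing F := inferInstance
  haveI : NullSingletonClass dx := nullSingletonClass_of_isAddHaarMeasure dx
  obtain ⟨a, ha0, ha1⟩ := exists_ne_zero_ne_one (F := F)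
  set U : Matrix (Fin 3) (Fin 3) (MvPolynomial (Fin 7) F) :=
    !![MvPolynomial.X 0, MvPolynomial.X 1, MvPolynomial.X 2; MvPolynomial.X 3, MvPolynomial.X 4, MvPolynomial.X 5; 0, 0, MvPolynomial.X 6] with hU
  have hset : {r : Fin 7 → F | (!![r 0, r 1, r 2; r 3, r 4, r 5; 0, 0, r 6] : Matrix (Fin 3) (Fin 3) F).charpoly.discr = 0} =
      {r : Fin 7 → F | MvPolynomial.eval (fun i => id (r i)) U.charpoly.discr = 0} := by
    ext r
    simp only [Set.mem_setOf_eq, id]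
    rw [show (fun i => r i) = r from rfl, ← discr_charpoly_map_eval U r, hU, map_eval_universal_seven]
  rw [hset]
  exact Literature.MeasureTheory.Constructions.pi_zeroLocus_mvPolynomial_eq_zero (K := F) (X := F) (e := id) measurable_id
    Function.injective_id dx 7 _ (by rw [hU]; exact discr_charpoly_universal_seven_ne_zero ha0 ha1)

variable [MeasurableSpace (Matrix (Fin 3) (Fin 3) F)] [BorelSpace (Matrix (Fin 3) (Fin 3) F)]

/-- **(1) THE SINGULAR SET `{disc χ_X = 0}` OF `𝔤𝔩₃(F)` IS HAAR-NULL** (through the entry chart `F⁹ ≃ M₃(F)` and uniqueness of Haar measure it is the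
`dx^{⊗9}`-measure of the zero locus of the non-zero polynomial `disc χ_{U₉}`). [cite: HarishChandra1999AdmissibleDistributions, §7] [cite: WeilBNT1967, Ch. I §2] -/
theorem measure_setOf_discr_charpoly_eq_zero (μ𝔤 : Measure (Matrix (Fin 3) (Fin 3) F)) [μ𝔤.IsAddHaarMeasure] :
    μ𝔤 {X : Matrix (Fin 3) (Fin 3) F | X.charpoly.discr = 0} = 0 := by
  classical
  haveI : T2Space F := (isLocalField F).toT2Space
  haveI : LocallyCompactSpace F := (isLocalField F).toLocallyCompactSpace
  haveI : SecondCountableTopology F := secondCountableTopology_localField F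
  haveI : IsTopologicalRing F := inferInstance
  haveI : SecondCountableTopology (Matrix (Fin 3) (Fin 3) F) := inferInstanceAs (SecondCountableTopology (Fin 3 → Fin 3 → F))
  haveI : LocallyCompactSpace (Matrix (Fin 3) (Fin 3) F) := Pi.locallyCompactSpace_of_finite
  -- an auxiliary atomless additive Haar measure on `F` and the entry chart
  set dx : Measure F := Measure.addHaar with hdx
  haveI : NullSingletonClass dx := nullSingletonClass_of_isAddHaarMeasure dx
  set chart : (Fin 9 → F) → Matrix (Fin 3) (Fin 3) F := fun y => !![y 0, y 1, y 2; y 3, y 4, y 5; y 6, y 7, y 8] with hchart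
  have hcont : Continuous chart := continuous_matrix fun i j => by fin_cases i <;> fin_cases j <;> simp [hchart] <;> fun_prop
  have hcont' : Continuous fun Y : Matrix (Fin 3) (Fin 3) F => (![Y 0 0, Y 0 1, Y 0 2, Y 1 0, Y 1 1, Y 1 2, Y 2 0, Y 2 1, Y 2 2] : Fin 9 → F) :=
    continuous_pi fun i => by fin_cases i <;> simp <;> fun_prop
  let φ : (Fin 9 → F) ≃+ Matrix (Fin 3) (Fin 3) F :=
    { toFun := chart
      invFun := fun Y => ![Y 0 0, Y 0 1, Y 0 2, Y 1 0, Y 1 1, Y 1 2, Y 2 0, Y 2 1, Y 2 2]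
      left_inv := fun y => by funext i; fin_cases i <;> simp [hchart]
      right_inv := fun Y => by ext i j; fin_cases i <;> fin_cases j <;> simp [hchart]
      map_add' := fun x y => by ext i j; fin_cases i <;> fin_cases j <;> simp [hchart] }
  have hφ : (φ : (Fin 9 → F) → Matrix (Fin 3) (Fin 3) F) = chart := rfl
  set ν : Measure (Matrix (Fin 3) (Fin 3) F) := Measure.map chart (Measure.pi fun _ : Fin 9 => dx) with hν
  haveI : ν.IsAddHaarMeasure := by rw [hν, ← hφ]; exact AddEquiv.isAddHaarMeasure_map _ φ hcont hcont'
  have huniq : μ𝔤 = μ𝔤.addHaarScalarFactor ν • ν := isAddLeftInvariant_eq_smul μ𝔤 ν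
  have hS : MeasurableSet {X : Matrix (Fin 3) (Fin 3) F | X.charpoly.discr = 0} :=
    (isClosed_eq (F0P3cStCharTSHCDGroupToLie.continuous_discr_charpoly (K := F)) continuous_const).measurableSet
  have happ : μ𝔤 {X : Matrix (Fin 3) (Fin 3) F | X.charpoly.discr = 0} = (μ𝔤.addHaarScalarFactor ν • ν) {X : Matrix (Fin 3) (Fin 3) F | X.charpoly.discr = 0} :=
    congrArg (fun m : Measure (Matrix (Fin 3) (Fin 3) F) => m {X : Matrix (Fin 3) (Fin 3) F | X.charpoly.discr = 0}) huniq
  have hνS : ν {X : Matrix (Fin 3) (Fin 3) F | X.charpoly.discr = 0} =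
      (Measure.pi fun _ : Fin 9 => dx) (chart ⁻¹' {X : Matrix (Fin 3) (Fin 3) F | X.charpoly.discr = 0}) := by
    rw [hν]; exact Measure.map_apply hcont.measurable hS
  rw [happ, Measure.smul_apply, hνS]
  -- the preimage is the zero locus of `disc χ_{U₉}`
  obtain ⟨a, ha0, ha1⟩ := exists_ne_zero_ne_one (F := F)
  set U : Matrix (Fin 3) (Fin 3) (MvPolynomial (Fin 9) F) :=
    !![MvPolynomial.X 0, MvPolynomial.X 1, MvPolynomial.X 2; MvPolynomial.X 3, MvPolynomial.X 4, MvPolynomial.X 5;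
      MvPolynomial.X 6, MvPolynomial.X 7, MvPolynomial.X 8] with hU
  have hpre : chart ⁻¹' {X : Matrix (Fin 3) (Fin 3) F | X.charpoly.discr = 0} = {y : Fin 9 → F | MvPolynomial.eval (fun i => id (y i)) U.charpoly.discr = 0} := by
    ext y
    simp only [Set.mem_preimage, Set.mem_setOf_eq, id, hchart]
    rw [show (fun i => y i) = y from rfl, ← discr_charpoly_map_eval U y, hU, map_eval_universal_nine]
  rw [hpre, Literature.MeasureTheory.Constructions.pi_zeroLocus_mvPolynomial_eq_zero (K := F) (X := F) (e := id) measurable_id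
    Function.injective_id dx 9 _ (by rw [hU]; exact discr_charpoly_universal_nine_ne_zero ha0 ha1), smul_zero]

end LocalField

end Summit.HodgeConjecture.HodgeConjecture.Cruxes.H413.K2E3GL3CharpolyDiscNull

end
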